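import Literature.MathematicalPhysics.QuantumFieldTheory.BalabanImbrieJaffe1984to88.BIJ88GaussShellInterpolated309

/-!
# `BalabanImbrieJaffe1984to88.BIJ88GaussShellLocalDrift309` — T. Bałaban, J. Imbrie, A. Jaffe, *Effective action and cluster properties of
the abelian Higgs model*, Commun. Math. Phys. **114** (1988) 257–315 [BalabanImbrieJaffe1988]: p. 307 [PDF 51] L5–13 (Sect. 5.13), verbatim:
*"Functional derivatives hitting χ-factors farther than ½r(e_k) from Λ₁₀^{(k)c} produce factors e^{−cp(e_k)²} after integrating with respect to
A^{(k)″}, φ^{(k)″}. These derivatives are supported at |A^{(k)″}| ≥ cp(e_k) or |φ^{(k)″}| ≥ cp(e_k) (here we use the fact that the translation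
vanishes). … Functional derivatives hitting χ′-factors within ½r(e_k) of Λ₁₀^{(k)c} are connected through C_ω(α) to Λ₁₁^{(k)}, so we get small
factors e^{−cr(e_k)} from the exponential decay of the operators C_s and Δ in C_ω(α)"* — **THE GAUSSIAN SHELL FACTORS WITH A LOCAL DRIFT:
THE MEAN OF EACH SLOT FIELD ENTERS ITS OWN SHELL ONLY**.

`BIJ88GaussShellInterpolated309.shift_real_forall_abs_ge_le` bounds the mean of every slot field `ℓ_k` under the translated Gaussian law by the
GLOBAL letter `ΛF/m` from `‖f‖₂ ≤ F` — the total ℓ²-mass of the source on the region, which is not uniform in the number of cubes (owner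
pre-filing review v2.386 of the size-free located (5.14.4), road (α)).  Here the same Chernoff route (`BIJ88GaussMultiShell307`) is run with a
PER-SLOT drift letter `|ℓ_k(A⁻¹f)| ≤ D_k` — the mean of `ℓ_k` under the law translated by `A⁻¹f` IS `ℓ_k(A⁻¹f)` — so that a local bound on the
translation seen by slot `k` (print: the χ-factors far from `Λ_f` see a vanishing translation; near `Λ_f` the decay of `C_s` localizes it) replaces
`ΛF/m`:
* `integral_linear_shift_eq` — `E[ℓ] = ℓ(v)` under the law translated by `v`;
* `shift_real_forall_abs_ge_le_local` — `Law{a_k ≤ |ℓ_k| ∀k} ≤ Π_k 2e^{−a_k(a_k − 2D_k)/(2Λ²/m)}`;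
* `abs_gexp_le_shell_local`, **`abs_gexp_prec_le_shell_local`** — the shell bound of a factor supported in the shells, generic and for the located
  data `⟨·⟩_{s,X}` (precision `prec blk Δ X s`, source `src blk ℱ X`), with the drift letter `|Φ_b(ext((prec)⁻¹ src))| ≤ D_b` per slot.
The size-free discharge of `D_b` from the `Δ`-letters (Combes–Thomas decay of `(prec)⁻¹`, sitewise source, locality of `Φ_b`) is the assembly's.

statement-level skeleton of published theorems with citation tags; proofs where landed; nothing here is a claim about the Yang–Mills mass gap

PDF held: `paper:balaban1988-cmp114-bij-abelian-higgs-effective-action` p. 307 (p0051 L5–13) re-read this session as text.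

CITATION HEADER (lean-in-tree rule).  Part of the lit-balaban TYPED SKELETON (HOME `run/shared/lean/pub/lit-balaban/`), Phase 2, seat p36
(gen 23, unit `lit-balaban-p36`); rows **C2.Eq5.14.3-5.14.4** (member: road (α) of the owner review v2.386 — local drift in the E4a shells) and
C2.Eq5.13.3-5.13.4 (member) of `HOME/lit-balaban-r16/ROWS-C2-part2.md` (owner r16, referee ref-5).  Theorem-only; no definitions, no `Prop`
facts; axioms standard.  HONEST SCOPE: the Chebyshev/Chernoff route of `BIJ88GaussMultiShell307` (not [3] §14); real scalar fields on finite
carriers; the frame letter `Λ`, the coercivity `m` and the per-slot drifts `D_k` are inputs.  NOT summit progress; NOT continuum; NOT Clay.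

REVISION v1.1 (doc-only, owner item D-owner-v2.389): the p. 307 L5–13 quotation above now carries print's region symbols `Λ₁₀^{(k)c}`,
`Λ₁₁^{(k)}` and *"χ′-factors"*; no declaration changed.
-/

namespace Literature.MathematicalPhysics.QuantumFieldTheory.BalabanImbrieJaffe1984to88.BIJ88GaussShellLocalDrift309

open MeasureTheory ProbabilityTheory Finset Matrix
open scoped BigOperators
open Literature.MathematicalPhysics.QuantumFieldTheory.Balaban1983to89
open B2Eq228Conditioning (gaussProb isProbabilityMeasure_gaussProb)
open BIJ88TruncationConnected306 (gexp)
open BIJ88PolymerRep5134Gauss (ext prec src)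
open BIJ88SlotFieldGaussBounds (ext_dotProduct_ext)
open BIJ88GaussMultiShell307 (measureReal_forall_abs_ge_le_of_hasGaussianLaw)
open BIJ88GaussShellInterpolated309 (hasGaussianLaw_linear_shift linear_eq_dotProduct integral_dotProduct_shift variance_linear_shift_le
  abs_le_of_frame isLinearMap_sum abs_gexp_le_of_indicator prec_posDef_of_mem_cube dotProduct_prec_mulVec_ge_of_mem_cube)

/-! ## §1  The mean of a linear functional under the translated law -/

section Generic

variable {n : Type} [Fintype n] [DecidableEq n] {A : Matrix n n ℝ}

/-- **`E[ℓ] = ℓ(v)` under the centred Gaussian law translated by `v`**, `ℓ` linear (p. 307: the shells see *"the translation"*).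
[cite: BalabanImbrieJaffe1988, §5.13 p.305, p.307 L5–8] -/
theorem integral_linear_shift_eq (hA : A.PosDef) (v : n → ℝ) {ℓ : (n → ℝ) → ℝ} (hℓ : IsLinearMap ℝ ℓ) :
    ∫ ω, ℓ ω ∂((gaussProb A).map fun z => z + v) = ℓ v := by
  have h1 : ℓ = fun ω => (fun i => ℓ (Pi.single i 1)) ⬝ᵥ ω := funext fun ω => linear_eq_dotProduct hℓ ω
  rw [h1, integral_dotProduct_shift hA]

/-! ## §2  The multi-shell bound with per-slot drifts -/

/-- **THE MULTI-SHELL BOUND UNDER THE TRANSLATED LAW, LOCAL DRIFTS**: `A ≥ m` (`m > 0`), linear `ℓ_k` with the frame letter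
`|Σ_kθ_kℓ_k(ω)| ≤ Λ‖θ‖₂‖ω‖₂` (`Λ > 0`), per-slot drifts `|ℓ_k(A⁻¹f)| ≤ D_k`, thresholds `a_k ≥ 0`:
`Law{a_k ≤ |ℓ_k| for all k} ≤ Π_k 2e^{−a_k(a_k − 2D_k)/(2Λ²/m)}`. [cite: BalabanImbrieJaffe1988, §5.13 p.307 L5–13] -/
theorem shift_real_forall_abs_ge_le_local {κ : Type*} [Fintype κ] [DecidableEq κ] (hA : A.PosDef) {m : ℝ} (hm : 0 < m)
    (hAm : ∀ w : n → ℝ, m * (w ⬝ᵥ w) ≤ w ⬝ᵥ (A *ᵥ w)) (f : n → ℝ) {ℓ : κ → (n → ℝ) → ℝ} (hℓ : ∀ k, IsLinearMap ℝ (ℓ k)) {Λ : ℝ}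
    (hΛ : 0 < Λ) (hframe : ∀ (θ : κ → ℝ) (ω : n → ℝ), |∑ k, θ k * ℓ k ω| ≤ Λ * Real.sqrt (∑ k, θ k ^ 2) * Real.sqrt (ω ⬝ᵥ ω))
    {D : κ → ℝ} (hD : ∀ k, |ℓ k (A⁻¹ *ᵥ f)| ≤ D k) {a : κ → ℝ} (ha : ∀ k, 0 ≤ a k) :
    ((gaussProb A).map fun z => z + A⁻¹ *ᵥ f).real {ω | ∀ k, a k ≤ |ℓ k ω|} ≤
      ∏ k, 2 * Real.exp (-(a k * (a k - 2 * D k) / (2 * (Λ ^ 2 / m)))) := by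
  have hJ := hasGaussianLaw_linear_shift hA (A⁻¹ *ᵥ f) hℓ
  haveI := hJ.isProbabilityMeasure
  refine measureReal_forall_abs_ge_le_of_hasGaussianLaw (X := fun k ω => ℓ k ω) hJ (by positivity) (fun θ => ?_) (fun k => ?_) ha
  · have hθ : 0 ≤ ∑ k, θ k ^ 2 := Finset.sum_nonneg fun k _ => sq_nonneg _
    have h := variance_linear_shift_le hA hm hAm (A⁻¹ *ᵥ f) (isLinearMap_sum hℓ θ) (Λ := Λ * Real.sqrt (∑ k, θ k ^ 2))
      (by positivity) (fun ω => hframe θ ω)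
    refine h.trans (le_of_eq ?_)
    rw [mul_pow, Real.sq_sqrt hθ]; ring
  · rw [integral_linear_shift_eq hA (A⁻¹ *ᵥ f) (hℓ k)]
    exact hD k

/-- **`|⟨G⟩| ≤ M · Π_k 2e^{−a_k(a_k−2D_k)/(2Λ²/m)}` for a factor supported in the shells**, local drifts.
[cite: BalabanImbrieJaffe1988, §5.13 p.307 L5–13, (5.14.4) p.309] -/
theorem abs_gexp_le_shell_local {κ : Type*} [Fintype κ] [DecidableEq κ] (hA : A.PosDef) {m : ℝ} (hm : 0 < m)
    (hAm : ∀ w : n → ℝ, m * (w ⬝ᵥ w) ≤ w ⬝ᵥ (A *ᵥ w)) (f : n → ℝ) {ℓ : κ → (n → ℝ) → ℝ} (hℓ : ∀ k, IsLinearMap ℝ (ℓ k)) {Λ : ℝ}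
    (hΛ : 0 < Λ) (hframe : ∀ (θ : κ → ℝ) (ω : n → ℝ), |∑ k, θ k * ℓ k ω| ≤ Λ * Real.sqrt (∑ k, θ k ^ 2) * Real.sqrt (ω ⬝ᵥ ω))
    {D : κ → ℝ} (hD : ∀ k, |ℓ k (A⁻¹ *ᵥ f)| ≤ D k) {a : κ → ℝ} (ha : ∀ k, 0 ≤ a k) {G : (n → ℝ) → ℝ} {M : ℝ} (hM : 0 ≤ M)
    (hG : ∀ ω, |G ω| ≤ M * {ω : n → ℝ | ∀ k, a k ≤ |ℓ k ω|}.indicator 1 ω) :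
    |gexp A f G| ≤ M * ∏ k, 2 * Real.exp (-(a k * (a k - 2 * D k) / (2 * (Λ ^ 2 / m)))) := by
  have hcont : ∀ k, Continuous (ℓ k) := fun k => ((hℓ k).mk' (ℓ k)).continuous_of_finiteDimensional
  have hS : MeasurableSet {ω : n → ℝ | ∀ k, a k ≤ |ℓ k ω|} := by
    have h1 : {ω : n → ℝ | ∀ k, a k ≤ |ℓ k ω|} = ⋂ k, {ω | a k ≤ |ℓ k ω|} := by
      ext ω
      simp
    rw [h1]
    exact MeasurableSet.iInter fun k => measurableSet_le measurable_const (continuous_abs.measurable.comp (hcont k).measurable)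
  exact (abs_gexp_le_of_indicator hA f hS hG).trans
    (mul_le_mul_of_nonneg_left (shift_real_forall_abs_ge_le_local hA hm hAm f hℓ hΛ hframe hD ha) hM)

end Generic

/-! ## §3  The located data: `⟨·⟩_{s,X}` with the drift seen by each slot field -/

section Located

variable {α I : Type} [Fintype α] [DecidableEq α] [Fintype I] [DecidableEq I] (blk : α → I) (Δ : Matrix α α ℝ) (ℱ : α → ℝ)
  {ι : Type} {B' : Finset ι} {Φ : ι → (α → ℝ) → ℝ}

/-- **THE SHELL BOUND FOR `⟨·⟩_{s,X}` WITH LOCAL DRIFTS**: `Δ ≻ 0`, `Δ ≥ m`, `s ∈ [0,1]^I`; linear slot fields `Φ_b`, `b ∈ B′`, with the frame letter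
`Λ`; the drift letter `|Φ_b(ext((prec blk Δ X s)⁻¹ (src blk ℱ X)))| ≤ D_b` per slot; thresholds `a_b ≥ 0`; if `|G(ω)| ≤ M·1{a_b ≤ |Φ_b(ext ω)| ∀b}`
then `|gexp (prec blk Δ X s) (src blk ℱ X) G| ≤ M · Π_b 2e^{−a_b(a_b − 2D_b)/(2Λ²/m)}` — `BIJ88GaussShellInterpolated309.abs_gexp_prec_le_shell`
with `ΛF/m` replaced slot by slot. [cite: BalabanImbrieJaffe1988, §5.13 p.307 L5–13, (5.14.3)–(5.14.4) p.309] -/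
theorem abs_gexp_prec_le_shell_local [DecidableEq ι] (hΔ : Δ.PosDef) {m : ℝ} (hm : 0 < m)
    (hΔm : ∀ φ : α → ℝ, m * (φ ⬝ᵥ φ) ≤ φ ⬝ᵥ (Δ *ᵥ φ)) {s : I → ℝ} (hs : ∀ i, 0 ≤ s i ∧ s i ≤ 1) (X : Finset I)
    (hlin : ∀ b ∈ B', IsLinearMap ℝ (Φ b)) {Λ : ℝ} (hΛ : 0 < Λ)
    (hframe : ∀ (θ : ↥B' → ℝ) (φ : α → ℝ), |∑ b : ↥B', θ b * Φ b φ| ≤ Λ * Real.sqrt (∑ b : ↥B', θ b ^ 2) * Real.sqrt (φ ⬝ᵥ φ))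
    {D : ↥B' → ℝ} (hD : ∀ b : ↥B', |Φ b (ext blk X ((prec blk Δ X s)⁻¹ *ᵥ src blk ℱ X))| ≤ D b) {a : ↥B' → ℝ} (ha : ∀ b, 0 ≤ a b)
    {G : ({x : α // blk x ∈ X} → ℝ) → ℝ} {M : ℝ} (hM : 0 ≤ M)
    (hG : ∀ ω, |G ω| ≤ M * {ω : {x : α // blk x ∈ X} → ℝ | ∀ b : ↥B', a b ≤ |Φ b (ext blk X ω)|}.indicator 1 ω) :
    |gexp (prec blk Δ X s) (src blk ℱ X) G| ≤ M * ∏ b : ↥B', 2 * Real.exp (-(a b * (a b - 2 * D b) / (2 * (Λ ^ 2 / m)))) := by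
  have hℓ : ∀ b : ↥B', IsLinearMap ℝ fun ω : {x : α // blk x ∈ X} → ℝ => Φ b (ext blk X ω) := fun b =>
    ⟨fun ω ω' => by rw [(BIJ88EffectiveActionGauss308.isLinearMap_ext blk X).map_add, (hlin b b.2).map_add],
      fun r ω => by rw [(BIJ88EffectiveActionGauss308.isLinearMap_ext blk X).map_smul, (hlin b b.2).map_smul]⟩
  have hframe' : ∀ (θ : ↥B' → ℝ) (ω : {x : α // blk x ∈ X} → ℝ),
      |∑ b : ↥B', θ b * Φ b (ext blk X ω)| ≤ Λ * Real.sqrt (∑ b : ↥B', θ b ^ 2) * Real.sqrt (ω ⬝ᵥ ω) := fun θ ω => by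
    rw [← ext_dotProduct_ext blk X ω ω]
    exact hframe θ (ext blk X ω)
  exact abs_gexp_le_shell_local (prec_posDef_of_mem_cube blk Δ hΔ hs X) hm (dotProduct_prec_mulVec_ge_of_mem_cube blk Δ hΔm hs X)
    (src blk ℱ X) hℓ hΛ hframe' (fun b => hD b) ha hM hG

end Located

end Literature.MathematicalPhysics.QuantumFieldTheory.BalabanImbrieJaffe1984to88.BIJ88GaussShellLocalDrift309
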